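import Summits.ABC.IUTFork.Cor312LicenceOfGradedReach
import Literature.IUT.LogVolume.UnitLogTorsionFreeBallCriterion
import HarnessLib

/-!
# [IUTchIII] Cor. 3.12 — the WILD TEMPLATE instantiated at BALL PLACES (tame `e ≤ p − 2`, or boundary `e = p − 1` without `ζ_p`),
# SEVERAL places over `p` allowed: the graded cell «`ord t_q ≥ (e·k+1) + j·max_{x'} (1 − e_{x'})`-in-`p`-units» ⟹ licence cell

PROOF-ONLY file (D-0012: 0 definitions, 0 `Prop` facts, no instance, no notation; abc-iut cell, rung LADDER-ABC:A2.RP → A2.RESCUE-H /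
A2.RESCUE-W; seat abc-iut-rp-h3 gen 5; item (α) of this lineage «I06⋆ cell ⇒ licence cell», MULTI-PLACE / BOUNDARY half — the first
instantiation of the WILD TEMPLATE `Cor312LicenceOfGradedReach` (p459744) where the log-unit lattice is known: BALL places). TAKES NO SIDE on
[IUTchIII] Cor. 3.12 or on any author; OUR typed objects only (abc-iut-c312-7's sharp settings over ANY `PilotData X`, Dupuy–Hilado's typed
(Ind2) `Real.ismDH` as ALL shell-preserving lattice automorphisms); typed ≠ proved; instantiated ≠ endorsed. INPUTS BY NAME: this lineage's
`exists_mem_ism_apply_eq_of_sameLevel` / `qRegion_subset_thetaHull_settingPrVolSharp_of_gradedReach` / `licence_settingPrVolSharp_of_gradedReach`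
(p459744, over abc-iut-w5-d107's multi-reach and abc-iut-w5-d180's transitivity), the ball evaluations of `log_p(𝒪^×)`: abc-iut-w5-d216 /
campaign-S `logUnits_eq_closedBall_of_tame` (tame) and abc-iut-w6-d060 `TorsionFree.logUnits_eq_closedBall_of_le_pred` (`e ≤ p − 1`, no `ζ_p`,
`p` odd — the BOUNDARY stratum of plan/rescue/R-H/START-HERE §1 included).

WHAT. At a BALL place `x | p` (`log_p(𝒪^×_x) = 𝔪_x = {‖y‖ ≤ ‖ϖ_x‖}`) the primitive levels of the log-unit lattice are the annuli
`{‖ϖ_x‖^{e k + e + 1} < ‖y‖ ≤ ‖ϖ_x‖^{e k + 1}}` (`e = e_x`, level `p^k`): the level of `1` is `k = −1` with outer element `ϖ_x^{1−e}` — UNIT-SLOT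
GAIN `‖ϖ_x‖^{1−e_x} = p^{1 − 1/e_x}` — and the level of a Θ-idele of norm `‖ϖ_x‖^b`, `e k + 1 ≤ b ≤ e k + e`, has outer element `ϖ_x^{e k+1}` —
PILOT REACH `‖ϖ_x‖^{e k + 1}`. So the WILD TEMPLATE's hypotheses are DECIDED at ball places, with NO uniqueness of the place over `p`
(this lineage's p450461 / abc-iut-w4-d087 needed a unique tame place; abc-iut-w5-d068's RH-TAME-JOIN uniformly tame fibres):
* §1 `mem_zpow_smul_closedBall_iff` — `z ∈ p^k·{‖y‖ ≤ ‖ϖ‖} ⟺ ‖z‖ ≤ ‖ϖ‖^{e k + 1}` (any complete `K ⊇ ℚ_p`, norm uniformizer `ϖ`).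
* §2 at a place `x | p` with `log_p(𝒪^×_x)` a ball: `exists_mem_ism_apply_eq_of_ball` (two elements of the same annulus are (Ind2)-related),
  **`unitGain_of_ball`** (gain `‖ϖ_x‖^{1−e_x}` with `y = 1`), **`pilotReach_of_ball`** (reach `‖ϖ_x‖^{e k+1}` for `‖t_{Θ,i,x}‖ = ‖ϖ_x‖^b`,
  `e k + 1 ≤ b ≤ e k + e`).
* §3 **`qRegion_subset_thetaHull_settingPrVolSharp_of_ballPlaces`** — at the packet `(i+1, p)`: every place `x | p` a ball place, a uniform
  `r ≥ 0` with `r ≤ ‖ϖ_x‖^{1−e_x}` at every `x` (so `r := min_x p^{1−1/e_x}`, binding at the LEAST ramified place over `p`), and the GRADED CELL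
  `‖t_{q,x}‖ ≤ ‖ϖ_x‖^{e_x k_x + 1} · r^{i+1}` at every `x` ⟹ licence cell; `gradedReach_of_identity` (primes where `‖t_q‖ ≤ ‖t_Θ‖`, e.g. all ideles
  units: the trivial graded data, `r = 1`); **`licence_settingPrVolSharp_of_ballPrimes`** / **`statement_settingPrVolSharp_of_ballPrimes`** — if
  at every prime either the identity reach or the ball data + graded cells hold (a set `B` of ball primes), the typed (xi-f) Licence and the typed
  Statement of Cor. 3.12 HOLD at the genuine sharp setting.
COLUMN READING (neutral): in `p`-units the cell at `(j, p)`, `x | p` a ball place, reads `ord_p(t_{q,x}) ≥ (e_x k_x + 1)/e_x − j·min_{x'|p}(1 − 1/e_{x'})`;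
with the honest profile `‖t_q‖ = ‖ϖ‖^m`, `‖t_{Θ,j}‖ = ‖ϖ‖^{j² m}` and ONE place over `p` this is `(j²−1)·m ≤ j·(e−1) + ((j²m − 1) mod e)` —
EXACTLY abc-iut-w5-d009's tame licence predicate (`tame_exact_iff_emod`; `e·⌊(j²m−1)/e⌋ = j²m − 1 − ((j²m−1) mod e)`): at one tame place the
template is SHARP, strictly weaker than this lineage's I06⋆ cell `(j²−1)m ≤ e−1` (p450461); several places: the LEAST ramified place over `p`
prices every unit slot. BOUNDARY places (`e = p−1`, no `ζ_p`) enter with the same formula.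
HONEST SCOPE as in the parent: sufficient, not exact (exact = abc-iut-c312-5's T2 iff); OUR sharp containers and DH's (Ind2); STRONGER-THAN-PRINT
packet licence; nothing about initial Θ-data of [IUTchI] Def. 3.1 or the printed inequality; nothing asserts or refutes [IUTchIII] Cor. 3.12.
[cite: DupuyHilado2025, §3.4, §3.9, §4.9] [cite: WeilBNT1967, Ch. II §2, Th. 1] [cite: NeukirchANT1999, Ch. II Prop. (5.5)–(5.7)]
[cite: ScholzeStix2018, §2.2 pp. 9–10] [claim: Mochizuki2012, status: disputed] for every IUT locution. Axioms: standard.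
-/

noncomputable section

open Set Metric Function NumberField IsDedekindDomain
open scoped Pointwise

namespace Summit.ABC.IUTFork.Thm311.Real

open Cor312 Cor312Vol Literature.IUT.LogThetaLattice Literature.IUT.LogVolume
  Literature.NumberTheory.NumberFields Literature.NumberTheory.GaloisRepresentations.Ultrametric

variable {F : Type} [Field F] [NumberField F] (X : PilotData F) {logv : PadicLogs F} (hlog : LogvAnalytic logv)
  (M : Type) [Field M] [NumberField M]
  (archPk : ∀ (j : (thetaIndex X).Label) (vQ : (thetaIndex X).VQ), Set ((logShellsDH X logv).Packet j vQ))
  (archSub : ∀ (j : (thetaIndex X).Label) (v : (thetaIndex X).V),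
    Set ((logShellsDH X logv).Packet j ((thetaIndex X).over v)))
  (Ψ : ℤ → ∀ v : (thetaIndex X).V, v ∈ (thetaIndex X).Vbad → Set ((logShellsDH X logv).StarPacket v))
  (act : ℤ → ∀ v : (thetaIndex X).V, v ∈ (thetaIndex X).Vbad →
    (logShellsDH X logv).StarPacket v → Module.End ℚ ((logShellsDH X logv).StarPacket v))
  (Mmod : ℤ → ∀ j : (thetaIndex X).LabelStar, Set ((logShellsDH X logv).GlobalPacket j.1))
  (region : ℤ → ∀ j : (thetaIndex X).LabelStar, FinDivisor M → ∀ vQ : (thetaIndex X).VQ,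
    Set ((logShellsDH X logv).Packet j.1 vQ))
  (n : ℤ) {HT : Type} {LogLink : HT → HT → Type} {IsFull : ∀ {s t : HT}, LogLink s t → Prop}
  (lat : LGPGaussianLogThetaLattice LogLink IsFull)
  {Frd : Type} {IsoF : Frd → Frd → Type} {Ob : Frd → Type} {realify : Frd → Frd} {Strip : Type}
  {IsoS : Strip → Strip → Type} {Mv : ∀ v : (thetaIndex X).V, v ∈ (thetaIndex X).Vbad → Type}
  [∀ v h, Monoid (Mv v h)]
  (sig : GlobalLGPFrobenioidSignature (thetaIndex X).lstar (thetaIndex X).V (· ∈ (thetaIndex X).Vbad)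
    Frd IsoF Ob realify Strip IsoS Mv)
  (split : SplittingMonoids Mv) {ObΔ : Type} {N : ∀ v : (thetaIndex X).V, v ∈ (thetaIndex X).Vbad → Type}
  [∀ v h, Monoid (N v h)] (qData : QPilotData ObΔ N)
  (tq : ∀ (pp : Nat.Primes) (x : (thetaIndex X).Fibre (.inr pp)), haveI : Fact (pp : ℕ).Prime := ⟨pp.2⟩; kOf X pp.1 x)
  (t : ∀ (pp : Nat.Primes) (_ : Fin X.lstar) (x : (thetaIndex X).Fibre (.inr pp)),
    haveI : Fact (pp : ℕ).Prime := ⟨pp.2⟩; kOf X pp.1 x)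
  (htq0 : ∀ pp x, tq pp x ≠ 0)
  (htq1 : ∀ (pp : Nat.Primes) (x : (thetaIndex X).Fibre (.inr pp)),
    haveI : Fact (pp : ℕ).Prime := ⟨pp.2⟩; placeOf X pp.1 x ∉ X.S → ‖tq pp x‖ = 1)

/-! ## 1. An (Ind2)-family acting on ALL tensor slots, and its effect on pure tensors -/

/-! ## §1. The primitive levels of a ball lattice are annuli -/

section Ball

variable (p : ℕ) [hp : Fact p.Prime]
variable {K : Type*} [NontriviallyNormedField K] [NormedAlgebra ℚ_[p] K] [IsUltrametricDist K] [ProperSpace K]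

/-- **`p^k · {‖y‖ ≤ ‖ϖ‖} = {‖y‖ ≤ ‖ϖ‖^{e k + 1}}`** for a norm uniformizer `ϖ` (`‖ϖ‖^e = p⁻¹`, `e = absRamificationIdx`). [folklore] -/
theorem mem_zpow_smul_closedBall_iff {ϖ : Kˣ} (hϖ : IsUniformizer ϖ) (k : ℤ) (z : K) :
    z ∈ ((p : ℚ_[p]) ^ k) • closedBall (0 : K) ‖(ϖ : K)‖ ↔ ‖z‖ ≤ ‖(ϖ : K)‖ ^ ((absRamificationIdx p K : ℤ) * k + 1) := by
  have hϖ0 : 0 < ‖(ϖ : K)‖ := norm_pos_iff.mpr ϖ.ne_zero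
  have hpe : ‖(ϖ : K)‖ ^ (absRamificationIdx p K : ℤ) = (p : ℝ)⁻¹ := by
    rw [zpow_natCast]; exact norm_pow_absRamificationIdx p K hϖ
  have hnp : ‖((p : ℚ_[p]) ^ k)‖ = ‖(ϖ : K)‖ ^ ((absRamificationIdx p K : ℤ) * k) := by
    rw [norm_zpow, Padic.norm_p, ← hpe, ← zpow_mul]
  rw [smul_closedBall _ _ (norm_nonneg _), smul_zero, hnp, mem_closedBall_zero_iff, zpow_add₀ hϖ0.ne', zpow_one]

/-- The annulus form of «same primitive level»: `‖z‖ ≤ ‖ϖ‖^{ek+1}` and NOT `‖z‖ ≤ ‖ϖ‖^{e(k+1)+1}`. [folklore] -/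
theorem not_mem_zpow_succ_smul_closedBall_iff {ϖ : Kˣ} (hϖ : IsUniformizer ϖ) (k : ℤ) (z : K) :
    z ∉ ((p : ℚ_[p]) * (p : ℚ_[p]) ^ k) • closedBall (0 : K) ‖(ϖ : K)‖ ↔
      ¬ ‖z‖ ≤ ‖(ϖ : K)‖ ^ ((absRamificationIdx p K : ℤ) * (k + 1) + 1) := by
  have hpc : (p : ℚ_[p]) * (p : ℚ_[p]) ^ k = (p : ℚ_[p]) ^ (k + 1) := by
    rw [zpow_add_one₀ (Nat.cast_ne_zero.mpr hp.out.ne_zero), mul_comm]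
  rw [hpc, mem_zpow_smul_closedBall_iff p hϖ]

end Ball

/-! ## §2. Gains and reaches at a BALL place of the fibre over `p` -/

section Place

variable (pp : Nat.Primes) [hpF : Fact (pp : ℕ).Prime]

/-- **Two elements of the same annulus `{‖ϖ‖^{ek+e+1} < ‖·‖ ≤ ‖ϖ‖^{ek+1}}` are related by a typed (Ind2)-mover** at a ball place `x | p`
(`log_p(𝒪^×_x) = {‖y‖ ≤ ‖ϖ‖}`): this lineage's `exists_mem_ism_apply_eq_of_sameLevel` at the level `p^k`. [cite: WeilBNT1967, Ch. II §2, Th. 1]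
[cite: DupuyHilado2025, §4.9] -/
theorem exists_mem_ism_apply_eq_of_ball (x : (thetaIndex X).Fibre (.inr pp)) {ϖ : (kOf X pp.1 x)ˣ} (hϖ : IsUniformizer ϖ)
    (hΛ : logUnits (kOf X pp.1 x) = closedBall (0 : kOf X pp.1 x) ‖(ϖ : kOf X pp.1 x)‖) (k : ℤ) {y z : kOf X pp.1 x}
    (hy1 : ‖y‖ ≤ ‖(ϖ : kOf X pp.1 x)‖ ^ ((absRamificationIdx pp.1 (kOf X pp.1 x) : ℤ) * k + 1))
    (hy2 : ¬ ‖y‖ ≤ ‖(ϖ : kOf X pp.1 x)‖ ^ ((absRamificationIdx pp.1 (kOf X pp.1 x) : ℤ) * (k + 1) + 1))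
    (hz1 : ‖z‖ ≤ ‖(ϖ : kOf X pp.1 x)‖ ^ ((absRamificationIdx pp.1 (kOf X pp.1 x) : ℤ) * k + 1))
    (hz2 : ¬ ‖z‖ ≤ ‖(ϖ : kOf X pp.1 x)‖ ^ ((absRamificationIdx pp.1 (kOf X pp.1 x) : ℤ) * (k + 1) + 1)) :
    ∃ g ∈ (logShellsDH X logv).ism x.1, (presAt X hlog pp).φ x (g (((presAt X hlog pp).φ x).symm y)) = z := by
  refine exists_mem_ism_apply_eq_of_sameLevel X hlog pp x ((pp.1 : ℚ_[pp.1]) ^ k) ?_ ?_ ?_ ?_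
  · show y ∈ ((pp.1 : ℚ_[pp.1]) ^ k) • logUnits (kOf X pp.1 x)
    rw [hΛ, mem_zpow_smul_closedBall_iff pp.1 hϖ]; exact hy1
  · show y ∉ ((pp.1 : ℚ_[pp.1]) * (pp.1 : ℚ_[pp.1]) ^ k) • logUnits (kOf X pp.1 x)
    rw [hΛ, not_mem_zpow_succ_smul_closedBall_iff pp.1 hϖ]; exact hy2
  · show z ∈ ((pp.1 : ℚ_[pp.1]) ^ k) • logUnits (kOf X pp.1 x)
    rw [hΛ, mem_zpow_smul_closedBall_iff pp.1 hϖ]; exact hz1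
  · show z ∉ ((pp.1 : ℚ_[pp.1]) * (pp.1 : ℚ_[pp.1]) ^ k) • logUnits (kOf X pp.1 x)
    rw [hΛ, not_mem_zpow_succ_smul_closedBall_iff pp.1 hϖ]; exact hz2

/-- **UNIT-SLOT GAIN AT A BALL PLACE: `‖ϖ_x‖^{1 − e_x}`** (the unit `1` and `ϖ_x^{1−e_x}` lie in the annulus of level `p⁻¹`; `y = 1`).
[cite: WeilBNT1967, Ch. II §2, Th. 1] [cite: DupuyHilado2025, §4.9] -/
theorem unitGain_of_ball (x : (thetaIndex X).Fibre (.inr pp)) {ϖ : (kOf X pp.1 x)ˣ} (hϖ : IsUniformizer ϖ)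
    (hΛ : logUnits (kOf X pp.1 x) = closedBall (0 : kOf X pp.1 x) ‖(ϖ : kOf X pp.1 x)‖) :
    ∃ g ∈ (logShellsDH X logv).ism x.1, ∃ y : kOf X pp.1 x, ‖y‖ ≤ 1 ∧
      ‖(ϖ : kOf X pp.1 x)‖ ^ (1 - (absRamificationIdx pp.1 (kOf X pp.1 x) : ℤ)) ≤
        ‖(presAt X hlog pp).φ x (g (((presAt X hlog pp).φ x).symm y))‖ := by
  have hϖ0 : 0 < ‖(ϖ : kOf X pp.1 x)‖ := norm_pos_iff.mpr ϖ.ne_zero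
  have hϖ1 : ‖(ϖ : kOf X pp.1 x)‖ < 1 := hϖ.1
  have he1 : 1 ≤ (absRamificationIdx pp.1 (kOf X pp.1 x) : ℤ) := by exact_mod_cast absRamificationIdx_pos pp.1 (kOf X pp.1 x)
  have hle : ∀ {a b : ℤ}, ‖(ϖ : kOf X pp.1 x)‖ ^ a ≤ ‖(ϖ : kOf X pp.1 x)‖ ^ b ↔ b ≤ a :=
    fun {a b} => zpow_le_zpow_iff_right_of_lt_one₀ hϖ0 hϖ1
  have hz : ‖(ϖ : kOf X pp.1 x) ^ (1 - (absRamificationIdx pp.1 (kOf X pp.1 x) : ℤ))‖ =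
      ‖(ϖ : kOf X pp.1 x)‖ ^ (1 - (absRamificationIdx pp.1 (kOf X pp.1 x) : ℤ)) := norm_zpow _ _
  obtain ⟨g, hg, hg1⟩ := exists_mem_ism_apply_eq_of_ball X hlog pp x hϖ hΛ (-1) (y := 1)
    (z := (ϖ : kOf X pp.1 x) ^ (1 - (absRamificationIdx pp.1 (kOf X pp.1 x) : ℤ)))
    (by rw [norm_one, ← zpow_zero ‖(ϖ : kOf X pp.1 x)‖, hle]; linarith)
    (by rw [norm_one, ← zpow_zero ‖(ϖ : kOf X pp.1 x)‖, hle]; omega)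
    (by rw [hz, hle]; linarith)
    (by rw [hz, hle]; omega)
  exact ⟨g, hg, 1, norm_one.le, le_of_eq (by rw [hg1]; exact hz.symm)⟩

/-- **PILOT REACH AT A BALL PLACE: `‖ϖ_x‖^{e k + 1}`** for a Θ-idele of norm `‖ϖ_x‖^b`, `e k + 1 ≤ b ≤ e k + e` (`t_{Θ,i,x}·1` and `ϖ_x^{ek+1}` share the
annulus of level `p^k`): the pilot-slot hypothesis of the WILD TEMPLATE with any factor `R`, `‖t_{q,x}‖ ≤ ‖ϖ_x‖^{e k + 1} · R`.
[cite: WeilBNT1967, Ch. II §2, Th. 1] [cite: DupuyHilado2025, §3.4, §4.9] -/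
theorem pilotReach_of_ball (x : (thetaIndex X).Fibre (.inr pp)) {ϖ : (kOf X pp.1 x)ˣ} (hϖ : IsUniformizer ϖ)
    (hΛ : logUnits (kOf X pp.1 x) = closedBall (0 : kOf X pp.1 x) ‖(ϖ : kOf X pp.1 x)‖) (i : Fin X.lstar) {b k : ℤ}
    (hb : ‖t pp i x‖ = ‖(ϖ : kOf X pp.1 x)‖ ^ b)
    (hk1 : (absRamificationIdx pp.1 (kOf X pp.1 x) : ℤ) * k + 1 ≤ b) (hk2 : b ≤ (absRamificationIdx pp.1 (kOf X pp.1 x) : ℤ) * k + absRamificationIdx pp.1 (kOf X pp.1 x))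
    {R : ℝ} (hR : ‖tq pp x‖ ≤ ‖(ϖ : kOf X pp.1 x)‖ ^ ((absRamificationIdx pp.1 (kOf X pp.1 x) : ℤ) * k + 1) * R) :
    ∃ g ∈ (logShellsDH X logv).ism x.1, ∃ y : kOf X pp.1 x, ‖y‖ ≤ 1 ∧
      ‖tq pp x‖ ≤ ‖(presAt X hlog pp).φ x (g (((presAt X hlog pp).φ x).symm (t pp i x * y)))‖ * R := by
  have hϖ0 : 0 < ‖(ϖ : kOf X pp.1 x)‖ := norm_pos_iff.mpr ϖ.ne_zero
  have hϖ1 : ‖(ϖ : kOf X pp.1 x)‖ < 1 := hϖ.1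
  have he1 : 1 ≤ (absRamificationIdx pp.1 (kOf X pp.1 x) : ℤ) := by exact_mod_cast absRamificationIdx_pos pp.1 (kOf X pp.1 x)
  have hle : ∀ {a c : ℤ}, ‖(ϖ : kOf X pp.1 x)‖ ^ a ≤ ‖(ϖ : kOf X pp.1 x)‖ ^ c ↔ c ≤ a :=
    fun {a c} => zpow_le_zpow_iff_right_of_lt_one₀ hϖ0 hϖ1
  have hz : ‖(ϖ : kOf X pp.1 x) ^ ((absRamificationIdx pp.1 (kOf X pp.1 x) : ℤ) * k + 1)‖ =
      ‖(ϖ : kOf X pp.1 x)‖ ^ ((absRamificationIdx pp.1 (kOf X pp.1 x) : ℤ) * k + 1) := norm_zpow _ _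
  obtain ⟨g, hg, hg1⟩ := exists_mem_ism_apply_eq_of_ball X hlog pp x hϖ hΛ k (y := t pp i x)
    (z := (ϖ : kOf X pp.1 x) ^ ((absRamificationIdx pp.1 (kOf X pp.1 x) : ℤ) * k + 1))
    (by rw [hb, hle]; exact hk1)
    (by rw [hb, hle]; linarith)
    (by rw [hz])
    (by rw [hz, hle]; linarith)
  refine ⟨g, hg, 1, norm_one.le, ?_⟩
  calc ‖tq pp x‖ ≤ ‖(ϖ : kOf X pp.1 x)‖ ^ ((absRamificationIdx pp.1 (kOf X pp.1 x) : ℤ) * k + 1) * R := hR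
    _ = _ := by rw [mul_one, hg1]; exact congrArg (· * R) hz.symm

end Place

/-! ## §3. The licence cell over a prime all of whose places are BALL places; the Licence and the Statement for ball primes -/

section Assembled

/-- **IDENTITY REACH** (e.g. a prime where all ideles are units): `‖t_{q,x}‖ ≤ ‖t_{Θ,i,x}‖` at every `x | p` gives the graded data with `r = 1`
(movers `id`, `y = 1`). [folklore] -/
theorem gradedReach_of_identity (pp : Nat.Primes) [Fact (pp : ℕ).Prime] (i : Fin (thetaIndex X).lstar)
    (hle : ∀ x : (thetaIndex X).Fibre (.inr pp), ‖tq pp x‖ ≤ ‖t pp i x‖) :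
    (∀ x : (thetaIndex X).Fibre (.inr pp), ∃ g ∈ (logShellsDH X logv).ism x.1, ∃ y : kOf X pp.1 x, ‖y‖ ≤ 1 ∧
        (1 : ℝ) ≤ ‖(presAt X hlog pp).φ x (g (((presAt X hlog pp).φ x).symm y))‖) ∧
      ∀ x : (thetaIndex X).Fibre (.inr pp), ∃ g ∈ (logShellsDH X logv).ism x.1, ∃ y : kOf X pp.1 x, ‖y‖ ≤ 1 ∧
        ‖tq pp x‖ ≤ ‖(presAt X hlog pp).φ x (g (((presAt X hlog pp).φ x).symm (t pp i x * y)))‖ * (1 : ℝ) ^ ((i : ℕ) + 1) :=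
  ⟨fun x => ⟨LinearEquiv.refl ℚ _, (logShellsDH X logv).one_mem_ism x.1, 1, norm_one.le,
      by rw [LinearEquiv.refl_apply, LinearEquiv.apply_symm_apply]; exact le_of_eq (norm_one (α := kOf X pp.1 x)).symm⟩,
    fun x => ⟨LinearEquiv.refl ℚ _, (logShellsDH X logv).one_mem_ism x.1, 1, norm_one.le,
      by rw [mul_one, one_pow, mul_one, LinearEquiv.refl_apply, LinearEquiv.apply_symm_apply]; exact hle x⟩⟩

/-- **THE LICENCE CELL OVER A BALL PRIME, SEVERAL PLACES ALLOWED.** At the packet `(i+1, p)` of the print-normalised sharp setting: if every place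
`x | p` is a BALL place (`log_p(𝒪^×_x) = {‖y‖ ≤ ‖ϖ_x‖}` for norm uniformizers `ϖ_x`), `0 ≤ r ≤ ‖ϖ_x‖^{1−e_x}` at every `x` (uniform unit-slot gain,
binding at the least ramified place), the Θ-ideles have norms `‖ϖ_x‖^{b_x}` with `e_x k_x + 1 ≤ b_x ≤ e_x k_x + e_x`, and the GRADED CELL
`‖t_{q,x}‖ ≤ ‖ϖ_x‖^{e_x k_x + 1} · r^{i+1}` holds at every `x`, then `qRegion (i+1) p ⊆ thetaHull (i+1) p`. [cite: DupuyHilado2025, §3.4, §3.9, §4.9]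
[cite: WeilBNT1967, Ch. II §2, Th. 1] [claim: Mochizuki2012, status: disputed] -/
theorem qRegion_subset_thetaHull_settingPrVolSharp_of_ballPlaces (pp : Nat.Primes) [Fact (pp : ℕ).Prime] (i : Fin (thetaIndex X).lstar)
    (ϖ : ∀ x : (thetaIndex X).Fibre (.inr pp), (kOf X pp.1 x)ˣ) (hϖ : ∀ x, IsUniformizer (ϖ x))
    (hΛ : ∀ x, logUnits (kOf X pp.1 x) = closedBall (0 : kOf X pp.1 x) ‖(ϖ x : kOf X pp.1 x)‖)
    {r : ℝ} (hr : 0 ≤ r) (hrle : ∀ x, r ≤ ‖(ϖ x : kOf X pp.1 x)‖ ^ (1 - (absRamificationIdx pp.1 (kOf X pp.1 x) : ℤ)))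
    (b k : (thetaIndex X).Fibre (.inr pp) → ℤ) (hb : ∀ x, ‖t pp i x‖ = ‖(ϖ x : kOf X pp.1 x)‖ ^ b x)
    (hk : ∀ x, (absRamificationIdx pp.1 (kOf X pp.1 x) : ℤ) * k x + 1 ≤ b x ∧
      b x ≤ (absRamificationIdx pp.1 (kOf X pp.1 x) : ℤ) * k x + absRamificationIdx pp.1 (kOf X pp.1 x))
    (hcell : ∀ x, ‖tq pp x‖ ≤ ‖(ϖ x : kOf X pp.1 x)‖ ^ ((absRamificationIdx pp.1 (kOf X pp.1 x) : ℤ) * k x + 1) * r ^ ((i : ℕ) + 1)) :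
    (settingPrVolSharp X hlog M archPk archSub Ψ act Mmod region n lat sig split qData tq t htq0 htq1).qRegion
        (Setting.labelSucc i) (.inr pp) ⊆
      (settingPrVolSharp X hlog M archPk archSub Ψ act Mmod region n lat sig split qData tq t htq0 htq1).thetaHull
        (Setting.labelSucc i) (.inr pp) :=
  qRegion_subset_thetaHull_settingPrVolSharp_of_gradedReach X hlog M archPk archSub Ψ act Mmod region n lat sig split qData tq t htq0 htq1
    pp i hr
    (fun x => by
      obtain ⟨g, hg, y, hy, hle⟩ := unitGain_of_ball X hlog pp x (hϖ x) (hΛ x)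
      exact ⟨g, hg, y, hy, (hrle x).trans hle⟩)
    fun x => pilotReach_of_ball X hlog tq t pp x (hϖ x) (hΛ x) i (hb x) (hk x).1 (hk x).2 (hcell x)

/-- **THE (xi-f) LICENCE WHEN EVERY PRIME IS A BALL PRIME OR AN IDENTITY-REACH PRIME.** `B` = the set of primes handled by ball data (every place
over them a ball place, with gains `r_p`, profiles `b, k` and graded cells as above); at every other prime `‖t_{q,x}‖ ≤ ‖t_{Θ,i,x}‖` (e.g. all ideles
units). Then `Thm311ToCor312.Licence (settingPrVolSharp …)`. [cite: DupuyHilado2025, §3.4, §3.9, §4.9] [claim: Mochizuki2012, status: disputed] -/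
theorem licence_settingPrVolSharp_of_ballPrimes (B : Set Nat.Primes)
    (hid : ∀ pp ∉ B, ∀ (i : Fin (thetaIndex X).lstar) (x : (thetaIndex X).Fibre (.inr pp)), ‖tq pp x‖ ≤ ‖t pp i x‖)
    (rB : Nat.Primes → ℝ) (hrB : ∀ pp ∈ B, 0 ≤ rB pp)
    (hball : ∀ pp ∈ B, haveI : Fact (pp : ℕ).Prime := ⟨pp.2⟩
      ∀ x : (thetaIndex X).Fibre (.inr pp), ∃ ϖ : (kOf X pp.1 x)ˣ, IsUniformizer ϖ ∧
        logUnits (kOf X pp.1 x) = closedBall (0 : kOf X pp.1 x) ‖(ϖ : kOf X pp.1 x)‖ ∧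
        rB pp ≤ ‖(ϖ : kOf X pp.1 x)‖ ^ (1 - (absRamificationIdx pp.1 (kOf X pp.1 x) : ℤ)) ∧
        ∀ i : Fin (thetaIndex X).lstar, ∃ b k : ℤ, ‖t pp i x‖ = ‖(ϖ : kOf X pp.1 x)‖ ^ b ∧
          (absRamificationIdx pp.1 (kOf X pp.1 x) : ℤ) * k + 1 ≤ b ∧ b ≤ (absRamificationIdx pp.1 (kOf X pp.1 x) : ℤ) * k + absRamificationIdx pp.1 (kOf X pp.1 x) ∧
          ‖tq pp x‖ ≤ ‖(ϖ : kOf X pp.1 x)‖ ^ ((absRamificationIdx pp.1 (kOf X pp.1 x) : ℤ) * k + 1) * rB pp ^ ((i : ℕ) + 1)) :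
    Thm311ToCor312.Licence (settingPrVolSharp X hlog M archPk archSub Ψ act Mmod region n lat sig split qData tq t htq0 htq1) := by
  classical
  refine licence_settingPrVolSharp_of_gradedReach X hlog M archPk archSub Ψ act Mmod region n lat sig split qData tq t htq0 htq1
    (fun pp _ => if pp ∈ B then rB pp else 1) (fun pp i => ?_) (fun pp i => ?_) (fun pp i => ?_)
  · split_ifs with h
    exacts [hrB pp h, zero_le_one]
  · haveI : Fact (pp : ℕ).Prime := ⟨pp.2⟩
    intro x
    by_cases hB : pp ∈ B
    · obtain ⟨ϖ, hϖ, hΛ, hrle, -⟩ := hball pp hB x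
      obtain ⟨g, hg, y, hy, hle⟩ := unitGain_of_ball X hlog pp x hϖ hΛ
      refine ⟨g, hg, y, hy, ?_⟩
      rw [if_pos hB]
      exact hrle.trans hle
    · rw [if_neg hB]
      exact (gradedReach_of_identity X hlog tq t pp i (hid pp hB i)).1 x
  · haveI : Fact (pp : ℕ).Prime := ⟨pp.2⟩
    intro x
    by_cases hB : pp ∈ B
    · obtain ⟨ϖ, hϖ, hΛ, -, hprof⟩ := hball pp hB x
      obtain ⟨b, k, hb, hk1, hk2, hcell⟩ := hprof i
      rw [if_pos hB]
      exact pilotReach_of_ball X hlog tq t pp x hϖ hΛ i hb hk1 hk2 hcell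
    · rw [if_neg hB]
      exact (gradedReach_of_identity X hlog tq t pp i (hid pp hB i)).2 x

/-- **… hence the typed Statement of [IUTchIII] Cor. 3.12 at the genuine sharp setting** for ball primes + identity primes (ideles non-zero and units
off `S`). [cite: DupuyHilado2025, §3.4, §3.9, §4.9] [claim: Mochizuki2012, status: disputed] -/
theorem statement_settingPrVolSharp_of_ballPrimes (ht0 : ∀ pp i x, t pp i x ≠ 0)
    (ht1 : ∀ (pp : Nat.Primes) (i : Fin X.lstar) (x : (thetaIndex X).Fibre (.inr pp)),
      haveI : Fact (pp : ℕ).Prime := ⟨pp.2⟩; placeOf X pp.1 x ∉ X.S → ‖t pp i x‖ = 1)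
    (B : Set Nat.Primes)
    (hid : ∀ pp ∉ B, ∀ (i : Fin (thetaIndex X).lstar) (x : (thetaIndex X).Fibre (.inr pp)), ‖tq pp x‖ ≤ ‖t pp i x‖)
    (rB : Nat.Primes → ℝ) (hrB : ∀ pp ∈ B, 0 ≤ rB pp)
    (hball : ∀ pp ∈ B, haveI : Fact (pp : ℕ).Prime := ⟨pp.2⟩
      ∀ x : (thetaIndex X).Fibre (.inr pp), ∃ ϖ : (kOf X pp.1 x)ˣ, IsUniformizer ϖ ∧
        logUnits (kOf X pp.1 x) = closedBall (0 : kOf X pp.1 x) ‖(ϖ : kOf X pp.1 x)‖ ∧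
        rB pp ≤ ‖(ϖ : kOf X pp.1 x)‖ ^ (1 - (absRamificationIdx pp.1 (kOf X pp.1 x) : ℤ)) ∧
        ∀ i : Fin (thetaIndex X).lstar, ∃ b k : ℤ, ‖t pp i x‖ = ‖(ϖ : kOf X pp.1 x)‖ ^ b ∧
          (absRamificationIdx pp.1 (kOf X pp.1 x) : ℤ) * k + 1 ≤ b ∧ b ≤ (absRamificationIdx pp.1 (kOf X pp.1 x) : ℤ) * k + absRamificationIdx pp.1 (kOf X pp.1 x) ∧
          ‖tq pp x‖ ≤ ‖(ϖ : kOf X pp.1 x)‖ ^ ((absRamificationIdx pp.1 (kOf X pp.1 x) : ℤ) * k + 1) * rB pp ^ ((i : ℕ) + 1)) :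
    (settingPrVolSharp X hlog M archPk archSub Ψ act Mmod region n lat sig split qData tq t htq0 htq1).Statement :=
  Thm311ToCor312.statement_of_licence
    (bridgeHyps_settingPrVolSharp_of_ideles X hlog M archPk archSub Ψ act Mmod region n lat sig split qData t tq ht0 ht1 htq0 htq1)
    (licence_settingPrVolSharp_of_ballPrimes X hlog M archPk archSub Ψ act Mmod region n lat sig split qData tq t htq0 htq1 B hid rB hrB hball)

/-- **BALL PLACES, BY NAME**: a TAME place (`p > 2`, `e_x ≤ p − 2`; campaign-S / abc-iut-w5-d216 `logUnits_eq_closedBall_of_tame`) and a BOUNDARY or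
tame place WITHOUT `ζ_p` (`p` odd, `e_x ≤ p − 1`, no `ζ ≠ 1` with `ζ^p = 1`; abc-iut-w6-d060 `TorsionFree.logUnits_eq_closedBall_of_le_pred`) are ball places.
[cite: NeukirchANT1999, Ch. II Prop. (5.5)–(5.7)] [claim: Mochizuki2012, status: disputed] -/
theorem logUnits_kOf_eq_closedBall_of_le_pred (pp : Nat.Primes) [Fact (pp : ℕ).Prime] (x : (thetaIndex X).Fibre (.inr pp))
    {ϖ : (kOf X pp.1 x)ˣ} (hϖ : IsUniformizer ϖ) (hp2 : (pp : ℕ) ≠ 2)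
    (hμ : ∀ ζ : kOf X pp.1 x, ζ ^ (pp : ℕ) = 1 → ζ = 1) (he : absRamificationIdx pp.1 (kOf X pp.1 x) ≤ (pp : ℕ) - 1) :
    logUnits (kOf X pp.1 x) = closedBall (0 : kOf X pp.1 x) ‖(ϖ : kOf X pp.1 x)‖ :=
  TorsionFree.logUnits_eq_closedBall_of_le_pred pp.1 hϖ hμ hp2 he

end Assembled

end Summit.ABC.IUTFork.Thm311.Real

end
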